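import Summits.BirchSwinnertonDyer.BirchSwinnertonDyer.Theorems.ByReductionTypeAtTwoOrdKatoHalfAtTwoIsoIrrMuDoor
import Summits.BirchSwinnertonDyer.BirchSwinnertonDyer.Theorems.ByReductionTypeAtTwoOrdKatoHalfAtTwoIsoOptimalMemberMuDoor
import Summits.BirchSwinnertonDyer.BirchSwinnertonDyer.Theorems.ByReductionTypeAtTwoOrdKatoHalfAtTwoIsoConjATwoOfNotSurjective
import HarnessLib

/-!
# Route ByReductionTypeAtTwo, crux `OrdKatoHalfAtTwoIso` (stmt-BirchSwinnertonDyer-19573), child B7′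
# (stmt-BirchSwinnertonDyer-23921 `OrdKatoMuPartOptimalAtTwo` = `KatoMuPartOff514AtOptimalMemberOfNotSurjectiveTwo`):
# B7′ BY NAME ⟸ PRINT {Abbes–Ullmo, modularity, Lim 2017 Thm 3.5 at 2, Ferrero–Washington} + the COLEMAN `μ`-PACKAGE
# (the assembly of this lane's doors; theorems only)

Seat `cruxlead-stmt-BirchSwinnertonDyer-19573-w2` GEN 3 (prover WIDTH under LEAD cruxlead-19573 g5; HOME
`run/shared/lean/pub/bsd-2adic/`; `--supports` stmt-BirchSwinnertonDyer-23921; pen RC-386 (iii)/RC-387). HONEST FRAMING (cell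
bsd-2adic): BSD is not proved by any of this; neither the crux nor B7′ is proved here; THEOREMS ONLY. CONDITIONAL on FOUR PUBLISHED
facts by name — Abbes–Ullmo (`abbesUllmo_not_dvd_maninConstant_of_not_dvd_level`), modularity (`nonempty_modularParametrizationData`,
the route's PUB first conjunct), Lim 2017 Thm. 3.5 at `p = 2` (`Lim2017.thm35_at_two_…_divisionField_four`, on its honest totally
imaginary carrier `ℚ(E[2], √−1)`), Ferrero–Washington (`ferreroWashington1979_classicalMuVanishes`) — and on TWO displayed
beyond-print binders, both SPAN-FREE COLEMAN `μ`-PACKAGES (readings of Kato §§12–17 at `2`; nothing asserted):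

* (Colμ-C₃) on «good ordinary at `2`, `E[2]` irreducible, `ρ̄₂` not onto», AT THE CURVE: for every newform, cyclotomic and dual data
  an ideal `P ⊆ Λ`, `M ⊆ P` killed by `τ : P → X`, `π : X ↠ X₀` exact after `τ`, and for every `G₁` with `ι G₁ = L₂(f, α)` an
  `s ∉ (2)` with `s·G₁ ∈ M`;
* (Colμ-opt-red) the same AT EVERY LATTICE-OPTIMAL MEMBER `W₀` (`Λ_{W₀} = c₀·Λ_f`) of every non-CM good-ordinary `E[2]`-REDUCIBLE class.

Everything else in B7′ is print or kernel: the member choice (optimal member, Edixhoven), clause (b) (Abbes–Ullmo at the optimal member,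
p692385), Coates–Sujatha's statement (A) at `2` on the whole habitat (Lim@2 + Ferrero–Washington through `ℚ(E[2], i)`, addL2x GEN 9;
`…ConjATwoOfNotSurjective`), the `μ`-bookkeeping (`…IrrMuDoor`: `μ = 0` on the `C₃` part with the tree's analytic `μ₂ = 0`;
`…OptimalMemberMuDoor`: `μ(X) ≤ μ(G)` with slack on the reducible part), reducibility along the isogeny to the optimal member
(`Rank1Residual.not_hasIrreducibleModPGaloisRep_of_isIsogenous`). The `C₃` part is keyed at `W` itself (clause (b) print at every
member of an irreducible class, p654400/p680193), which avoids transporting «`ρ̄₂` not onto» to the optimal member.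

* `katoMuPartOff514_of_print_of_colemanMuPackages` — B7′ from the four print facts and the two Coleman binders.
* `ordKatoMuPartOptimalAtTwo_of_print_of_colemanMuPackages` — the route decl of child 23921, same inputs.

What this is NOT: the Coleman `μ`-packages are NOT proved (F-27a / p691215: on `0 < Δ`, where the whole `C₃` habitat and the `Δ > 0`
reducible classes live, the classes with `col = u·L₂` are Kato's HALF classes — beyond print); B7′ and the crux stay OPEN.

References: [AbbesUllmo1996] Thm. A; [EdixhovenManin1991] Prop. 2; [Lim2017FineSelmer] Thm. 3.5, Lemma 3.2; [FerreroWashington1979];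
[Kato2004Asterisque] §17.13; [GreenbergLNM1716] §1 p. 60, p. 170; MEMO-7 (HOME); pen RC-386–RC-390; this lane's files p692385,
p693670, p694319, p694876, p695632.
-/

set_option autoImplicit false
set_option linter.dupNamespace false

noncomputable section

open scoped Classical MatrixGroups ModularForm NumberField
open CongruenceSubgroup WeierstrassCurve Field IsDedekindDomain NumberField
open Literature.NumberTheory.GaloisRepresentations
open Literature.NumberTheory.GaloisCohomology
open Literature.NumberTheory.EllipticCurves Literature.NumberTheory.EllipticCurves.ModularForms
open Literature.NumberTheory.EllipticCurves.Kato2004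
open Literature.NumberTheory.EllipticCurves.Rank1Residual
open Literature.NumberTheory.EllipticCurves.Greenberg1999
open Literature.NumberTheory.IwasawaTheory
open Summit.BirchSwinnertonDyer.Rank1Residual Summit.BirchSwinnertonDyer.Rank1Residual.X5
open Summit.BirchSwinnertonDyer.BirchSwinnertonDyer.Theorems.OrdKatoOptimalAtTwo
  Summit.BirchSwinnertonDyer.BirchSwinnertonDyer.Theorems.OrdKatoIntAtTwo
open Summit.BirchSwinnertonDyer.BirchSwinnertonDyer.Theses.ByReductionTypeAtTwo

namespace Summit.BirchSwinnertonDyer.BirchSwinnertonDyer.Theorems.SteinbergFibreAtTwo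

/-- **B7′ `KatoMuPartOff514AtOptimalMemberOfNotSurjectiveTwo` (child stmt-BirchSwinnertonDyer-23921) BY NAME from FOUR PRINT FACTS
(Abbes–Ullmo, modularity, Lim 2017 Thm. 3.5 at `2`, Ferrero–Washington) and TWO span-free COLEMAN `μ`-PACKAGES** — (Colμ-C₃) at the
curve on the `C₃` part, (Colμ-opt-red) at every lattice-optimal member on the reducible part. Assembly: `katoMuPartOff514_of_split`
(p680193) ∘ [`C₃`: `katoMuPartIrrNotSurjectiveTwo_of_colemanMuPackage_of_finite_fineSelmer` (p693670) with (A₂-C₃) := `conjATwo_C3_habitat`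
(p695632)] ∘ [reducible: `katoMuPartOff514Reducible_of_optimalMember` (p692385), left disjunct by
`katoMuPartAtTwo_of_colemanMuPackage_of_finite_fineSelmer_of_integralRatio` (p694319) with (A₂) := `conjATwo_reducible_optimal_habitat`
(p695632) and `ord₂ ϖ = 0` at the optimal member (p692385)]. Conditional; nothing closed.
[cite: AbbesUllmo1996, Thm. A] [cite: Lim2017FineSelmer, §3 Thm. 3.5 and Lemma 3.2] [cite: FerreroWashington1979, main theorem]
[cite: Kato2004Asterisque, §17.13 (pp. 279–280) (shape of the Coleman package; nothing asserted)] -/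
theorem katoMuPartOff514_of_print_of_colemanMuPackages
    (hAU : abbesUllmo_not_dvd_maninConstant_of_not_dvd_level) (hMod : nonempty_modularParametrizationData)
    (hLim2 : Lim2017.thm35_at_two_fineSelmerDual_moduleFinite_of_classicalMuVanishes_of_le_divisionField_four)
    (hFW : ferreroWashington1979_classicalMuVanishes)
    (hC3 : ∀ (W : WeierstrassCurve ℚ) [W.IsElliptic] [W.IsGloballyMinimal] {N : ℕ} [NeZero N]
      (f : CuspForm (Gamma0 N) 2) (κ : ZpExtension ℚ 2) (γ : absoluteGaloisGroup ℚ),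
      κ.IsCyclotomic → IsOrdinaryAt W 2 → W.HasIrreducibleModPGaloisRep 2 → ¬ W.HasSurjectiveModNGaloisRep 2 →
      κ.IsTopGenerator γ → IsCyclotomicVariable 2 γ → IsNewformOf W f →
      ∀ (D : W.SelmerDualData κ γ) (Y : W.FineSelmerDualData κ γ),
        ∃ (P : Submodule (IwasawaAlgebra 2) (IwasawaAlgebra 2)) (M : Submodule (IwasawaAlgebra 2) P)
          (τ : P →ₗ[IwasawaAlgebra 2] D.X) (π : D.X →ₗ[IwasawaAlgebra 2] Y.X),
          (∀ m ∈ M, τ m = 0) ∧ Function.Surjective π ∧ Function.Exact τ π ∧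
          ∀ G₁ : IwasawaAlgebra 2, iwasawaToPowerSeries 2 G₁ = padicLFunction f (unitRoot W 2 : ℚ_[2]) →
            ∃ s : IwasawaAlgebra 2, s ∉ IwasawaAlgebra.augIdealP 2 ∧ s * G₁ ∈ Submodule.map P.subtype M)
    (hCred : ∀ (W : WeierstrassCurve ℚ) [W.IsElliptic] [W.IsGloballyMinimal],
      ¬ W.HasCM → GoodOrd W 2 → ¬ W.HasIrreducibleModPGaloisRep 2 →
      ∀ (W₀ : WeierstrassCurve ℚ) [W₀.IsElliptic] [W₀.IsGloballyMinimal] {N₀ : ℕ} [NeZero N₀]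
        (D₀ : ModularParametrizationData W₀ N₀), WeierstrassCurve.IsIsogenous W W₀ →
        (∀ z ∈ D₀.L.lattice, ∃ w ∈ periodLattice D₀.f, z = D₀.c * w) →
      ∀ {N : ℕ} [NeZero N] (f : CuspForm (Gamma0 N) 2) (κ : ZpExtension ℚ 2) (γ : absoluteGaloisGroup ℚ),
        κ.IsCyclotomic → κ.IsTopGenerator γ → IsCyclotomicVariable 2 γ → IsNewformOf W₀ f →
        ∀ (D : W₀.SelmerDualData κ γ) (Y : W₀.FineSelmerDualData κ γ),
          ∃ (P : Submodule (IwasawaAlgebra 2) (IwasawaAlgebra 2)) (M : Submodule (IwasawaAlgebra 2) P)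
            (τ : P →ₗ[IwasawaAlgebra 2] D.X) (π : D.X →ₗ[IwasawaAlgebra 2] Y.X),
            (∀ m ∈ M, τ m = 0) ∧ Function.Surjective π ∧ Function.Exact τ π ∧
            ∀ G₁ : IwasawaAlgebra 2, iwasawaToPowerSeries 2 G₁ = padicLFunction f (unitRoot W₀ 2 : ℚ_[2]) →
              ∃ s : IwasawaAlgebra 2, s ∉ IwasawaAlgebra.augIdealP 2 ∧ s * G₁ ∈ Submodule.map P.subtype M) :
    KatoMuPartOff514AtOptimalMemberOfNotSurjectiveTwo := by
  refine katoMuPartOff514_of_split hAU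
    (katoMuPartIrrNotSurjectiveTwo_of_colemanMuPackage_of_finite_fineSelmer hC3 (conjATwo_C3_habitat hLim2 hFW))
    (katoMuPartOff514Reducible_of_optimalMember hAU hMod ?_)
  intro W _ _ hcm hgo hred W₀ _ _ N₀ _ D₀ hiso hopt
  exact Or.inl <| katoMuPartAtTwo_of_colemanMuPackage_of_finite_fineSelmer_of_integralRatio W₀
    (fun f κ γ hκ hγ hγ' hf D Y ↦ hCred W hcm hgo hred W₀ D₀ hiso hopt f κ γ hκ hγ hγ' hf D Y)
    (conjATwo_reducible_optimal_habitat hLim2 hFW W hcm hgo hred W₀ D₀ hiso hopt)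
    (fun f hf ϖ hϖ ↦ (padicValRat_two_neronRatio_eq_zero_of_latticeOptimal_of_abbesUllmo hAU W₀
      (goodOrd_two_of_isIsogenous W hiso hgo).1 D₀ hopt f hf ϖ hϖ).ge)

/-- **The route's child `OrdKatoMuPartOptimalAtTwo` (stmt-BirchSwinnertonDyer-23921, text = B7′ verbatim) BY NAME from the same four
print facts and two Coleman binders.** Conditional; the item is NOT closed by this; nothing asserted.
[cite: AbbesUllmo1996, Thm. A] [cite: Lim2017FineSelmer, §3 Thm. 3.5 and Lemma 3.2] [cite: FerreroWashington1979, main theorem] -/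
theorem ordKatoMuPartOptimalAtTwo_of_print_of_colemanMuPackages
    (hAU : abbesUllmo_not_dvd_maninConstant_of_not_dvd_level) (hMod : nonempty_modularParametrizationData)
    (hLim2 : Lim2017.thm35_at_two_fineSelmerDual_moduleFinite_of_classicalMuVanishes_of_le_divisionField_four)
    (hFW : ferreroWashington1979_classicalMuVanishes)
    (hC3 : ∀ (W : WeierstrassCurve ℚ) [W.IsElliptic] [W.IsGloballyMinimal] {N : ℕ} [NeZero N]
      (f : CuspForm (Gamma0 N) 2) (κ : ZpExtension ℚ 2) (γ : absoluteGaloisGroup ℚ),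
      κ.IsCyclotomic → IsOrdinaryAt W 2 → W.HasIrreducibleModPGaloisRep 2 → ¬ W.HasSurjectiveModNGaloisRep 2 →
      κ.IsTopGenerator γ → IsCyclotomicVariable 2 γ → IsNewformOf W f →
      ∀ (D : W.SelmerDualData κ γ) (Y : W.FineSelmerDualData κ γ),
        ∃ (P : Submodule (IwasawaAlgebra 2) (IwasawaAlgebra 2)) (M : Submodule (IwasawaAlgebra 2) P)
          (τ : P →ₗ[IwasawaAlgebra 2] D.X) (π : D.X →ₗ[IwasawaAlgebra 2] Y.X),
          (∀ m ∈ M, τ m = 0) ∧ Function.Surjective π ∧ Function.Exact τ π ∧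
          ∀ G₁ : IwasawaAlgebra 2, iwasawaToPowerSeries 2 G₁ = padicLFunction f (unitRoot W 2 : ℚ_[2]) →
            ∃ s : IwasawaAlgebra 2, s ∉ IwasawaAlgebra.augIdealP 2 ∧ s * G₁ ∈ Submodule.map P.subtype M)
    (hCred : ∀ (W : WeierstrassCurve ℚ) [W.IsElliptic] [W.IsGloballyMinimal],
      ¬ W.HasCM → GoodOrd W 2 → ¬ W.HasIrreducibleModPGaloisRep 2 →
      ∀ (W₀ : WeierstrassCurve ℚ) [W₀.IsElliptic] [W₀.IsGloballyMinimal] {N₀ : ℕ} [NeZero N₀]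
        (D₀ : ModularParametrizationData W₀ N₀), WeierstrassCurve.IsIsogenous W W₀ →
        (∀ z ∈ D₀.L.lattice, ∃ w ∈ periodLattice D₀.f, z = D₀.c * w) →
      ∀ {N : ℕ} [NeZero N] (f : CuspForm (Gamma0 N) 2) (κ : ZpExtension ℚ 2) (γ : absoluteGaloisGroup ℚ),
        κ.IsCyclotomic → κ.IsTopGenerator γ → IsCyclotomicVariable 2 γ → IsNewformOf W₀ f →
        ∀ (D : W₀.SelmerDualData κ γ) (Y : W₀.FineSelmerDualData κ γ),
          ∃ (P : Submodule (IwasawaAlgebra 2) (IwasawaAlgebra 2)) (M : Submodule (IwasawaAlgebra 2) P)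
            (τ : P →ₗ[IwasawaAlgebra 2] D.X) (π : D.X →ₗ[IwasawaAlgebra 2] Y.X),
            (∀ m ∈ M, τ m = 0) ∧ Function.Surjective π ∧ Function.Exact τ π ∧
            ∀ G₁ : IwasawaAlgebra 2, iwasawaToPowerSeries 2 G₁ = padicLFunction f (unitRoot W₀ 2 : ℚ_[2]) →
              ∃ s : IwasawaAlgebra 2, s ∉ IwasawaAlgebra.augIdealP 2 ∧ s * G₁ ∈ Submodule.map P.subtype M) :
    OrdKatoMuPartOptimalAtTwo :=
  katoMuPartOff514_of_print_of_colemanMuPackages hAU hMod hLim2 hFW hC3 hCred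

end Summit.BirchSwinnertonDyer.BirchSwinnertonDyer.Theorems.SteinbergFibreAtTwo

end
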